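import Literature.GroupTheory.CombinatorialGroupTheory.PuncturedSurfaceGroupCuspBases
import Literature.GroupTheory.CombinatorialGroupTheory.PuncturedSurfaceGroupUnrQuotientCoprod
import HarnessLib

/-!
# The free basis of `Γ_{g,r+1}` eliminating the LAST puncture generator

`Γ_{g,r+1} = ⟨a_i, b_i, c_0, …, c_r ∣ [a_0,b_0]⋯[a_{g-1},b_{g-1}]·c_0⋯c_r⟩` (`PuncturedSurfaceGroup g (r+1)`,
[SemiAnbd] Example 2.10 [cite: MochizukiSemiAnbd2006, Ex. 2.10 p.31]).  Companion of
`PuncturedSurfaceGroupCuspBases.lean` (Tietze elimination of the FIRST, resp. SECOND, puncture generator):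
here the LAST one, `c_r = (c_0⋯c_{r-1})⁻¹ ([a_0,b_0]⋯[a_{g-1},b_{g-1}])⁻¹`, is eliminated, so that ALL of
`c_0, …, c_{r-1}` are letters of the resulting basis — the basis in which the vertex group of a component
carrying the cusps `c_0, …, c_{s-1}` (`s ≤ r`) is the closure of a free factor (two-component curves joined
by TWO nodes, abc-iut-f-164).

* `exists_mulEquiv_freeGroup_elim_last` — `Γ_{g,r+1} ≃* F((Fin g × Bool) ⊕ Fin r)`, `a_i, b_i ↦` their
  letters, `c_j ↦ inr j` for `j < r` (as `Fin.castSucc j`);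
* `exists_freeGroupBasis_elim_last` — the same packaged as a `FreeGroupBasis` with its values.
Theorems only; elementary combinatorial group theory.
-/

namespace Literature.GroupTheory.CombinatorialGroupTheory.PuncturedSurfaceGroup

variable (g r : ℕ)

/-- The relator of `Γ_{g,r+1}` with the LAST puncture generator isolated:
`[a_0,b_0]⋯[a_{g-1},b_{g-1}] · ((c_0⋯c_{r-1}) · c_r)`. [cite: MochizukiSemiAnbd2006, Ex. 2.10 p.31] -/
theorem relator_castSucc_last :
    relator g (r + 1) =
      ((List.finRange g).map fun i =>
          genA (r := r + 1) i * genB (r := r + 1) i * (genA (r := r + 1) i)⁻¹ *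
            (genB (r := r + 1) i)⁻¹).prod *
        (((List.finRange r).map fun j => genC (g := g) (Fin.castSucc j)).prod * genC (g := g) (Fin.last r)) := by
  rw [relator, prod_map_finRange_add]
  congr 2

/-- **`Γ_{g,r+1}` is free on `a_i, b_i, c_0, …, c_{r-1}`** (Tietze elimination of the LAST puncture
generator `c_r`), with the images recorded: `a_i ↦ inl (i,false)`, `b_i ↦ inl (i,true)`,
`c_j ↦ inr j` (`j < r`). [cite: MochizukiSemiAnbd2006, Ex. 2.10 p.31] -/
theorem exists_mulEquiv_freeGroup_elim_last :
    ∃ e : PuncturedSurfaceGroup g (r + 1) ≃* FreeGroup ((Fin g × Bool) ⊕ Fin r),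
      (∀ i, e (a i) = FreeGroup.of (Sum.inl (i, false))) ∧
      (∀ i, e (b i) = FreeGroup.of (Sum.inl (i, true))) ∧
      ∀ j : Fin r, e (c (Fin.castSucc j)) = FreeGroup.of (Sum.inr j) := by
  classical
  let comm : FreeGroup (puncturedSurfaceGen g (r + 1)) :=
    ((List.finRange g).map fun i =>
      genA (r := r + 1) i * genB (r := r + 1) i * (genA (r := r + 1) i)⁻¹ *
        (genB (r := r + 1) i)⁻¹).prod
  let cs : FreeGroup (puncturedSurfaceGen g (r + 1)) :=
    ((List.finRange r).map fun j => genC (g := g) (Fin.castSucc j)).prod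
  have hrel_eq : relator g (r + 1) = comm * (cs * genC (g := g) (Fin.last r)) := relator_castSucc_last g r
  let A : FreeGroup ((Fin g × Bool) ⊕ Fin r) := ((List.finRange g).map fun i =>
      FreeGroup.of (Sum.inl (i, false)) * FreeGroup.of (Sum.inl (i, true)) *
        (FreeGroup.of (Sum.inl (i, false)))⁻¹ * (FreeGroup.of (Sum.inl (i, true)))⁻¹).prod
  let B : FreeGroup ((Fin g × Bool) ⊕ Fin r) :=
    ((List.finRange r).map fun j => FreeGroup.of (Sum.inr j)).prod
  let f : puncturedSurfaceGen g (r + 1) → FreeGroup ((Fin g × Bool) ⊕ Fin r) := fun x =>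
    match x with
    | Sum.inl y => FreeGroup.of (Sum.inl y)
    | Sum.inr j => Fin.lastCases (motive := fun _ => FreeGroup ((Fin g × Bool) ⊕ Fin r))
        (B⁻¹ * A⁻¹) (fun j' => FreeGroup.of (Sum.inr j')) j
  have hfl : f (Sum.inr (Fin.last r)) = B⁻¹ * A⁻¹ := by simp [f]
  have hfs : ∀ j : Fin r, f (Sum.inr (Fin.castSucc j)) = FreeGroup.of (Sum.inr j) := fun j => by simp [f]
  have hfA : FreeGroup.lift f comm = A := by
    simp only [comm, A, map_list_prod, List.map_map, Function.comp_def, map_mul, map_inv, genA, genB,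
      FreeGroup.lift_apply_of, f]
  have hfB : FreeGroup.lift f cs = B := by
    simp only [cs, B, map_list_prod, List.map_map, Function.comp_def, genC, FreeGroup.lift_apply_of, hfs]
  have hrel : ∀ w ∈ ({relator g (r + 1)} : Set (FreeGroup (puncturedSurfaceGen g (r + 1)))),
      FreeGroup.lift f w = 1 := by
    intro w hw
    rw [Set.mem_singleton_iff] at hw
    rw [hw, hrel_eq, map_mul, map_mul, hfA, hfB, genC, FreeGroup.lift_apply_of, hfl]
    group
  let φ : PuncturedSurfaceGroup g (r + 1) →* FreeGroup ((Fin g × Bool) ⊕ Fin r) :=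
    PresentedGroup.toGroup hrel
  let ψ : FreeGroup ((Fin g × Bool) ⊕ Fin r) →* PuncturedSurfaceGroup g (r + 1) :=
    FreeGroup.lift fun y =>
      match y with
      | Sum.inl x => PresentedGroup.of (Sum.inl x)
      | Sum.inr j => PresentedGroup.of (Sum.inr (Fin.castSucc j))
  have hψA : ψ A = PresentedGroup.mk _ comm := by
    simp only [A, comm, map_list_prod, List.map_map, Function.comp_def, map_mul, map_inv, ψ,
      FreeGroup.lift_apply_of, genA, genB]
    rfl
  have hψB : ψ B = PresentedGroup.mk _ cs := by
    simp only [B, cs, map_list_prod, List.map_map, Function.comp_def, ψ, FreeGroup.lift_apply_of,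
      genC]
    rfl
  have hcl : (PresentedGroup.of (Sum.inr (Fin.last r)) : PuncturedSurfaceGroup g (r + 1)) =
      (PresentedGroup.mk _ cs)⁻¹ * (PresentedGroup.mk _ comm)⁻¹ := by
    have h1 := PresentedGroup.one_of_mem (rels := ({relator g (r + 1)} : Set _))
      (Set.mem_singleton (relator g (r + 1)))
    have h1' : PresentedGroup.mk ({relator g (r + 1)} : Set _) (comm * (cs * genC (g := g) (Fin.last r))) = 1 := by
      rw [← hrel_eq]; exact h1
    rw [map_mul, map_mul, ← mul_assoc] at h1'
    have h2 := eq_inv_of_mul_eq_one_right h1'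
    rw [mul_inv_rev] at h2
    exact h2
  have h₁ : ψ.comp φ = MonoidHom.id _ := by
    apply PresentedGroup.ext
    intro x
    rw [MonoidHom.comp_apply, MonoidHom.id_apply]
    change ψ (PresentedGroup.toGroup hrel (PresentedGroup.of x)) = _
    rw [PresentedGroup.toGroup.of]
    rcases x with y | j
    · simp [f, ψ]
    · refine Fin.lastCases ?_ (fun j' => ?_) j
      · rw [hfl, map_mul, map_inv, map_inv, hψA, hψB, hcl]
      · rw [hfs]
        simp [ψ]
  have h₂ : φ.comp ψ = MonoidHom.id _ := by
    apply FreeGroup.ext_hom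
    intro y
    rw [MonoidHom.comp_apply, MonoidHom.id_apply]
    rcases y with x | j
    · simp only [ψ, FreeGroup.lift_apply_of]
      change PresentedGroup.toGroup hrel (PresentedGroup.of (Sum.inl x)) = _
      rw [PresentedGroup.toGroup.of]
    · simp only [ψ, FreeGroup.lift_apply_of]
      change PresentedGroup.toGroup hrel (PresentedGroup.of (Sum.inr (Fin.castSucc j))) = _
      rw [PresentedGroup.toGroup.of, hfs]
  refine ⟨MonoidHom.toMulEquiv φ ψ h₁ h₂, fun i => ?_, fun i => ?_, fun j => ?_⟩
  · change PresentedGroup.toGroup hrel (PresentedGroup.of (Sum.inl (i, false))) = _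
    rw [PresentedGroup.toGroup.of]
  · change PresentedGroup.toGroup hrel (PresentedGroup.of (Sum.inl (i, true))) = _
    rw [PresentedGroup.toGroup.of]
  · change PresentedGroup.toGroup hrel (PresentedGroup.of (Sum.inr (Fin.castSucc j))) = _
    rw [PresentedGroup.toGroup.of, hfs]

variable {g r}

/-- **The `c_r`-eliminating free basis of `Γ_{g,r+1}`**, packaged: `b(i,false) = a_i`, `b(i,true) = b_i`,
`b(inr j) = c_j` for `j < r`. [cite: MochizukiSemiAnbd2006, Ex. 2.10 p.31] -/
theorem exists_freeGroupBasis_elim_last (g r : ℕ) :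
    ∃ bl : FreeGroupBasis ((Fin g × Bool) ⊕ Fin r) (PuncturedSurfaceGroup g (r + 1)),
      (∀ i, bl (Sum.inl (i, false)) = a i) ∧ (∀ i, bl (Sum.inl (i, true)) = b i) ∧
        ∀ j : Fin r, bl (Sum.inr j) = c (Fin.castSucc j) := by
  obtain ⟨e, hea, heb, hec⟩ := exists_mulEquiv_freeGroup_elim_last g r
  refine ⟨FreeGroupBasis.ofRepr e, fun i => ?_, fun i => ?_, fun j => ?_⟩
  · change e.symm (FreeGroup.of (Sum.inl (i, false))) = a i
    rw [← hea i, MulEquiv.symm_apply_apply]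
  · change e.symm (FreeGroup.of (Sum.inl (i, true))) = b i
    rw [← heb i, MulEquiv.symm_apply_apply]
  · change e.symm (FreeGroup.of (Sum.inr j)) = c (Fin.castSucc j)
    rw [← hec j, MulEquiv.symm_apply_apply]

end Literature.GroupTheory.CombinatorialGroupTheory.PuncturedSurfaceGroup
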